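import Literature.Probability.RandomPlanarGeometry.HexSAWBridgeLength
import Literature.Probability.RandomPlanarGeometry.HexSAWKestenRenewal
import Mathlib.Algebra.BigOperators.Intervals
import Mathlib.Algebra.Order.Interval.Finset.Basic
import HarnessLib

/-!
# Kesten's renewal equation BY LENGTH for the bridges of the hexagonal lattice (DCS strip frame)

Topic `Literature/Probability/RandomPlanarGeometry` (continues `HexSAWBridgeLength.lean` and `HexSAWIrreducibleBridges.lean`).
Sources: H. Kesten, *On the number of self-avoiding walks*, J. Math. Phys. 4 (1963), §4; N. Madras, G. Slade, *The
Self-Avoiding Walk* (1993), §4.2, eq. (4.2.2)–(4.2.4), pp. 90–91: every bridge is, uniquely, an irreducible bridge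
followed by a (possibly empty) bridge, cut at the first break point, whence `b_n = Σ_{k=1}^{n} λ_k b_{n-k}` (`b_0 = 1`),
i.e. `b_n = λ_n + Σ_{1 ≤ a < n} λ_a b_{n-a}`.  Here for Duminil-Copin–Smirnov's honeycomb bridges (walks `a → β` of the
strips `S_T`, Ann. of Math. 175 (2012), §3), graded by the number of vertices: the tree's cutting map
`l ↦ (low t l, highStd t l)` at the first renewal level (`HV.firstRen`, `HV.eq_of_low_eq_of_highStd_eq`) and Kesten's
concatenation `HV.brConcat` (`HV.brConcat_injOn`, `HV.firstRen_brConcat`) are LENGTH-ADDITIVE (`HV.length_brConcat`,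
`HV.length_eq_low_add_highStd`), so they restrict to bijections between the length fibres; the finite boxes `S_{T,L}`
are immaterial by box stability (`mem_bridgeLists_of_length_le`).

CONVENTIONS.  Lengths are numbers of VERTICES (the tree's strip partition functions weight a bridge by `x^{#vertices}`);
a bridge has an even number of vertices (`hvBridgeLen_odd`), so the renewal pair `u_m = b_{2m} x_c^{2m}`,
`f_k = λ_{2k} x_c^{2k}` is indexed by half the vertex count.  In this (Duminil-Copin–Smirnov strip) frame `λ_n(ℍ) = 2` for
`n = 2, 4, 6, 8` — the width-one zigzags are vacuously irreducible — not to be confused with the irreducible-bridge counts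
of the brick-wall frame (`HexSAWBrickWallRenewal.lean`, `λ_1 = 1` there), a different and inequivalent bridge family
(crossing perpendicular to an edge class rather than parallel to one).

PROVENANCE.  K87.1/K87.2 (the renewal equation by length, this file, and Kesten's relation by length,
`HexSAWBridgeLengthKesten.lean`) were first kernel-checked in HOME by a-idea-1 (Sketch_G14_R87 ed.9, 2026-08-22); the
proofs below are independent.

## Contents (namespace `Literature.Probability.RandomPlanarGeometry.SAW`)

* `brConcat_low_highStd` — `brConcat t (low t l) (highStd t l) = l` (the cut is undone by the concatenation);
* `card_filter_length_firstRen_eq` — per width `T` and first renewal level `t < T`, the length-`n` bridges with first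
  break at `t` are counted by `Σ_a λ_{t,a} · b_{T-t,n-a}`;
* `card_filter_length_bridgeLists_eq_add` — per width: `b_{T,n} = λ_{T,n} + Σ_{t<T} Σ_a λ_{t,a} b_{T-t,n-a}`;
* **`hvBridgeLen_eq_add_sum`** — `b_n(ℍ) = λ_n(ℍ) + Σ_{a ≤ n} λ_a(ℍ) b_{n-a}(ℍ)` (all `n`; the terms `a = 0`, `a = n`
  vanish since `λ_0 = b_0 = 0`), `hvBridgeLen_eq_add_sum_Ico`;
* **`hvBridgeLen_renewal_even`** — the half-length form `b_{2m} = λ_{2m} + Σ_{1 ≤ k < m} λ_{2k} b_{2(m-k)}` (`m ≥ 1`;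
  odd lengths carry no bridge), the counting identity behind the renewal equation `u_m = Σ_k f_k u_{m-k}` of the pair
  `u_m = b_{2m} x_c^{2m}`, `f_k = λ_{2k} x_c^{2k}`.
-/

noncomputable section

open Finset Literature.Probability.LatticeModels

namespace Literature.Probability.RandomPlanarGeometry.SAW

open HV

/- The strip finsets `HV.bridgeLists T L` are closed computable terms whose definitional unfolding is astronomically
expensive; nothing below unfolds them (membership goes through `HV.mem_bridgeLists_iff`), so they are sealed for the
unifier, and the length counts are wrapped in opaque local functions before any arithmetic. -/
attribute [local irreducible] bridgeLists

/-! ### The cut is undone by the concatenation -/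

/-- `brConcat t (low t l) (highStd t l) = l`: translating the standardised high piece back by the junction abscissa and
`t` levels recovers the high piece. [cite: Kesten1963SAW, §4; MadrasSlade1993, §4.2 (p. 90, "every bridge … can be
decomposed uniquely")] -/
theorem brConcat_low_highStd (t : ℕ) (l : List HV) : brConcat t (low t l) (highStd t l) = l := by
  rw [brConcat, ← jx, ← high_eq_map_highStd, low_append_high]

/-! ### The fibre of the first renewal level, at fixed length -/

/-- For `1 ≤ t < T`: the bridges of width `T` with `n` vertices (box `L = n`) whose FIRST renewal level is `t` are exactly
the concatenations `brConcat t l₁ l₂` of an irreducible bridge `l₁` of width `t` and a bridge `l₂` of width `T − t` with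
`|l₁| + |l₂| = n` (both in the box `L = n`). [cite: Kesten1963SAW, §4; MadrasSlade1993, §4.2, (4.2.2)] -/
theorem filter_firstRen_eq_image {T t n : ℕ} (ht : 1 ≤ t) (htT : t < T) :
    ((bridgeLists T n).filter fun l => l.length = n ∧ firstRen T l = t)
      = ((irrLists t n ×ˢ bridgeLists (T - t) n).filter fun p => p.1.length + p.2.length = n).image
          fun p => brConcat t p.1 p.2 := by
  have hT : 1 ≤ T := le_trans ht htT.le
  ext l
  simp only [mem_filter, mem_image, mem_product, Prod.exists]
  constructor
  · rintro ⟨hl, hlen, hfr⟩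
    obtain ⟨hr, hmin⟩ := firstRen_spec hfr htT
    refine ⟨low t l, highStd t l, ⟨⟨?_, ?_⟩, ?_⟩, brConcat_low_highStd t l⟩
    · rw [irrLists, mem_filter]
      exact ⟨low_mem_bridgeLists hT ht hl hr, isIrred_low hr hmin⟩
    · refine mem_bridgeLists_of_length_le (by omega) (highStd_mem_bridgeLists hT ht htT hl hr) ?_
      have := length_eq_low_add_highStd t l
      omega
    · rw [← length_eq_low_add_highStd, hlen]
  · rintro ⟨l₁, l₂, ⟨⟨h₁, h₂⟩, hlen⟩, rfl⟩
    have h₁' : l₁ ∈ bridgeLists t n := (mem_filter.1 h₁).1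
    refine ⟨mem_bridgeLists_of_length_le hT (brConcat_mem_bridgeLists ht htT h₁' h₂) ?_, ?_,
      firstRen_brConcat ht htT h₁ h₂⟩
    · rw [length_brConcat, hlen]
    · rw [length_brConcat, hlen]

/-- The pairs `(l₁, l₂)` with `|l₁| + |l₂| = n` split along `a = |l₁| ≤ n` into products of length fibres.
[cite: MadrasSlade1993, §4.2, (4.2.2)] -/
theorem card_filter_pairs_eq_sum (A B : Finset (List HV)) (n : ℕ) :
    #((A ×ˢ B).filter fun p => p.1.length + p.2.length = n)
      = ∑ a ∈ range (n + 1), #(A.filter fun l => l.length = a) * #(B.filter fun l => l.length = n - a) := by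
  rw [card_eq_sum_card_fiberwise (f := fun p : List HV × List HV => p.1.length) (t := range (n + 1))]
  · refine sum_congr rfl fun a ha => ?_
    rw [mem_range] at ha
    rw [← card_product]
    congr 1
    ext ⟨l₁, l₂⟩
    simp only [mem_filter, mem_product]
    constructor
    · rintro ⟨⟨⟨h1, h2⟩, hsum⟩, hlen⟩
      exact ⟨⟨h1, hlen⟩, h2, by omega⟩
    · rintro ⟨⟨h1, hlen⟩, h2, hlen2⟩
      exact ⟨⟨⟨h1, h2⟩, by omega⟩, hlen⟩
  · intro p hp
    simp only [mem_coe, mem_filter, mem_product, mem_range] at hp ⊢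
    omega

/-- **The first-renewal fibre is counted by a convolution**: for `1 ≤ t < T`,
`#{bridges of width T, n vertices, first break at t} = Σ_{a ≤ n} λ_{t,a} · b_{T-t,n-a}` (length fibres of the
irreducible bridges of width `t` and of the bridges of width `T − t`, box `L = n`). [cite: Kesten1963SAW, §4;
MadrasSlade1993, §4.2, (4.2.2)] -/
theorem card_filter_length_firstRen_eq {T t n : ℕ} (ht : 1 ≤ t) (htT : t < T) :
    #((bridgeLists T n).filter fun l => l.length = n ∧ firstRen T l = t)
      = ∑ a ∈ range (n + 1), #((irrLists t n).filter fun l => l.length = a)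
          * #((bridgeLists (T - t) n).filter fun l => l.length = n - a) := by
  rw [filter_firstRen_eq_image ht htT, card_image_of_injOn, card_filter_pairs_eq_sum]
  -- injectivity of the concatenation on (bridges of width t) × (bridges of width T - t)
  refine (brConcat_injOn (L := n) ht htT).mono fun p hp => ?_
  rw [mem_coe, mem_filter, mem_product] at hp
  rw [coe_product, Set.mem_prod, mem_coe, mem_coe]
  exact ⟨(mem_filter.1 hp.1.1).1, hp.1.2⟩

/-- The fibre `firstRen = T` (no break level below `T`) consists of the irreducible bridges.
[cite: Kesten1963SAW, §4; MadrasSlade1993, Definition 4.2.1] -/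
theorem filter_length_firstRen_self (T n : ℕ) :
    ((bridgeLists T n).filter fun l => l.length = n ∧ firstRen T l = T)
      = (irrLists T n).filter fun l => l.length = n := by
  ext l
  simp only [mem_filter, irrLists]
  constructor
  · rintro ⟨hl, hlen, hfr⟩
    exact ⟨⟨hl, isIrred_of_firstRen_eq hfr⟩, hlen⟩
  · rintro ⟨⟨hl, hirr⟩, hlen⟩
    exact ⟨hl, hlen, firstRen_of_isIrred hirr⟩

/-- **Per-width renewal identity at fixed length**: for `T ≥ 1`,
`b_{T,n} = λ_{T,n} + Σ_{1 ≤ t < T} Σ_{a ≤ n} λ_{t,a} · b_{T-t,n-a}` (all counts in the box `L = n`).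
[cite: Kesten1963SAW, §4; MadrasSlade1993, §4.2, (4.2.2)] -/
theorem card_filter_length_bridgeLists_eq_add {T : ℕ} (hT : 1 ≤ T) (n : ℕ) :
    #((bridgeLists T n).filter fun l => l.length = n)
      = #((irrLists T n).filter fun l => l.length = n)
        + ∑ t ∈ Ico 1 T, ∑ a ∈ range (n + 1), #((irrLists t n).filter fun l => l.length = a)
            * #((bridgeLists (T - t) n).filter fun l => l.length = n - a) := by
  -- partition the length fibre along the first renewal level `firstRen T ∈ [1, T]`
  have hfib := card_eq_sum_card_fiberwise (s := (bridgeLists T n).filter fun l => l.length = n)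
    (f := firstRen T) (t := Icc 1 T) fun l _ => mem_coe.2 (firstRen_mem_Icc hT l)
  rw [hfib, ← Finset.Ico_add_one_right_eq_Icc, sum_Ico_succ_top hT, add_comm]
  have hff : ∀ t, ((bridgeLists T n).filter fun l => l.length = n).filter (fun l => firstRen T l = t)
      = (bridgeLists T n).filter fun l => l.length = n ∧ firstRen T l = t := fun t => filter_filter _ _ _
  congr 1
  · rw [hff, filter_length_firstRen_self]
  · refine sum_congr rfl fun t hts => ?_
    rw [mem_Ico] at hts
    rw [hff, card_filter_length_firstRen_eq hts.1 hts.2]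

/-! ### Summing over the widths -/

/-- Reindexing the triangle `{1 ≤ t < T ≤ n}` by `(t, s = T − t)`. [cite: MadrasSlade1993, §4.2, (4.2.2)] -/
theorem sum_Icc_sum_Ico_eq (n : ℕ) (F : ℕ → ℕ → ℕ) :
    ∑ T ∈ Icc 1 n, ∑ t ∈ Ico 1 T, F t (T - t) = ∑ t ∈ Icc 1 n, ∑ s ∈ Icc 1 (n - t), F t s := by
  rw [sum_comm' (t' := Icc 1 n) (s' := fun t => Icc (t + 1) n)]
  · refine sum_congr rfl fun t ht => ?_
    rw [mem_Icc] at ht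
    have hn : n = (n - t) + t := by omega
    conv_lhs => rw [hn, show t + 1 = 1 + t from add_comm t 1, ← image_add_right_Icc]
    rw [sum_image fun x _ y _ h => by simpa using h]
    exact sum_congr rfl fun s _ => by rw [Nat.add_sub_cancel]
  · intro T t
    simp only [mem_Icc, mem_Ico]
    omega

/-- **Kesten's renewal equation by length on the hexagonal lattice (all `n`)**:
`b_n(ℍ) = λ_n(ℍ) + Σ_{a ≤ n} λ_a(ℍ) · b_{n-a}(ℍ)` — the terms `a = 0` and `a = n` vanish (`λ_0 = b_0 = 0`), so this is
`b_n = λ_n + Σ_{1 ≤ a < n} λ_a b_{n-a}`, Madras–Slade (4.2.2) with their convention `b_0 = 1` unfolded.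
[cite: Kesten1963SAW, §4 (eq. (4.6) shape); MadrasSlade1993, §4.2, (4.2.2), p. 90] -/
theorem hvBridgeLen_eq_add_sum (n : ℕ) :
    hvBridgeLen n = hvIrrLen n + ∑ a ∈ range (n + 1), hvIrrLen a * hvBridgeLen (n - a) := by
  /- KERNEL/ELABORATOR HYGIENE: the box-`n` length fibres are wrapped in opaque local functions `ι`, `β` (and `b_·`,
  `λ_·` in `B`, `Λ`) before any arithmetic, so that no unifier ever tries to evaluate a `Finset.card`. -/
  obtain ⟨ι, hι⟩ : ∃ ι : ℕ → ℕ → ℕ, ∀ t a, #((irrLists t n).filter fun l => l.length = a) = ι t a :=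
    ⟨_, fun _ _ => rfl⟩
  obtain ⟨β, hβ⟩ : ∃ β : ℕ → ℕ → ℕ, ∀ s b, #((bridgeLists s n).filter fun l => l.length = b) = β s b :=
    ⟨_, fun _ _ => rfl⟩
  obtain ⟨B, hB⟩ : ∃ B : ℕ → ℕ, ∀ j, hvBridgeLen j = B j := ⟨_, fun _ => rfl⟩
  obtain ⟨Λ, hΛ⟩ : ∃ Λ : ℕ → ℕ, ∀ j, hvIrrLen j = Λ j := ⟨_, fun _ => rfl⟩
  -- vanishing: `ι t a = 0` unless `2t ≤ a`, `β s b = 0` unless `2s ≤ b`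
  have hι0 : ∀ t a, 1 ≤ t → a < 2 * t → ι t a = 0 := fun t a ht h =>
    (hι t a).symm.trans (by rw [filter_length_irrLists_eq_empty ht h, card_empty])
  have hβ0 : ∀ s b, 1 ≤ s → b < 2 * s → β s b = 0 := fun s b hs h =>
    (hβ s b).symm.trans (by rw [filter_length_bridgeLists_eq_empty hs h, card_empty])
  -- the factors, read in the box `n` over the widths `≤ n` (box stability)
  have hΛsum : ∀ a, a ≤ n → Λ a = ∑ t ∈ Icc 1 n, ι t a := fun a ha =>
    (hΛ a).symm.trans ((hvIrrLen_eq_sum (N := n) (L := n) (by omega) ha).trans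
      (sum_congr rfl fun t _ => hι t a))
  have hBsum : ∀ a, B (n - a) = ∑ s ∈ Icc 1 n, β s (n - a) := fun a =>
    (hB (n - a)).symm.trans ((hvBridgeLen_eq_sum (n := n - a) (N := n) (L := n) (by omega) (by omega)).trans
      (sum_congr rfl fun s _ => hβ s (n - a)))
  -- Step 1: per-width identity summed over `T ≤ n`
  have h1 : hvBridgeLen n
      = hvIrrLen n + ∑ T ∈ Icc 1 n, ∑ t ∈ Ico 1 T, ∑ a ∈ range (n + 1), ι t a * β (T - t) (n - a) := by
    unfold hvBridgeLen hvIrrLen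
    rw [← sum_add_distrib]
    refine sum_congr rfl fun T hT => (card_filter_length_bridgeLists_eq_add (mem_Icc.1 hT).1 n).trans ?_
    exact congrArg₂ (· + ·) rfl
      (sum_congr rfl fun t _ => sum_congr rfl fun a _ => congrArg₂ (· * ·) (hι t a) (hβ (T - t) (n - a)))
  -- Step 2: reindex the triangle and extend the inner range (the added terms vanish)
  have h2 : ∑ T ∈ Icc 1 n, ∑ t ∈ Ico 1 T, ∑ a ∈ range (n + 1), ι t a * β (T - t) (n - a)
      = ∑ t ∈ Icc 1 n, ∑ s ∈ Icc 1 n, ∑ a ∈ range (n + 1), ι t a * β s (n - a) := by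
    rw [sum_Icc_sum_Ico_eq n fun t s => ∑ a ∈ range (n + 1), ι t a * β s (n - a)]
    refine sum_congr rfl fun t ht => ?_
    rw [mem_Icc] at ht
    refine sum_subset (Icc_subset_Icc_right (Nat.sub_le n t)) fun s hs hs' => ?_
    rw [mem_Icc] at hs
    have hst : n - t < s := by
      rw [mem_Icc, not_and_or, not_le, not_le] at hs'
      rcases hs' with h | h <;> omega
    refine sum_eq_zero fun a _ => ?_
    by_cases ha : a < 2 * t
    · rw [hι0 t a ht.1 ha, zero_mul]
    · rw [hβ0 s (n - a) hs.1 (by omega), mul_zero]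
  -- Step 3: swap the sums and factor
  have h3 : ∑ t ∈ Icc 1 n, ∑ s ∈ Icc 1 n, ∑ a ∈ range (n + 1), ι t a * β s (n - a)
      = ∑ a ∈ range (n + 1), (∑ t ∈ Icc 1 n, ι t a) * ∑ s ∈ Icc 1 n, β s (n - a) := by
    rw [sum_comm]
    refine (sum_congr rfl fun s _ => sum_comm).trans ?_
    rw [sum_comm]
    refine sum_congr rfl fun a _ => ?_
    rw [sum_mul_sum, sum_comm]
  -- Step 4: assemble (in the opaque symbols)
  simp only [hB, hΛ] at h1 ⊢
  rw [h1, h2, h3]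
  refine congrArg₂ (· + ·) rfl (sum_congr rfl fun a ha => ?_)
  rw [mem_range] at ha
  rw [hΛsum a (by omega), hBsum a]

/-- The same identity over `1 ≤ a < n`. [cite: MadrasSlade1993, §4.2, (4.2.2), p. 90] -/
theorem hvBridgeLen_eq_add_sum_Ico (n : ℕ) :
    hvBridgeLen n = hvIrrLen n + ∑ a ∈ Ico 1 n, hvIrrLen a * hvBridgeLen (n - a) := by
  have h := hvBridgeLen_eq_add_sum n
  obtain ⟨B, hB⟩ : ∃ B : ℕ → ℕ, ∀ j, hvBridgeLen j = B j := ⟨_, fun _ => rfl⟩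
  obtain ⟨Λ, hΛ⟩ : ∃ Λ : ℕ → ℕ, ∀ j, hvIrrLen j = Λ j := ⟨_, fun _ => rfl⟩
  have hB0 : B 0 = 0 := by rw [← hB, hvBridgeLen_zero]
  have hΛ0 : Λ 0 = 0 := by rw [← hΛ, hvIrrLen_zero]
  simp only [hB, hΛ] at h ⊢
  rw [h]
  refine congrArg₂ (· + ·) rfl ?_
  rcases Nat.eq_zero_or_pos n with rfl | hn
  · simp [hΛ0]
  · symm
    refine sum_subset (fun a ha => ?_) fun a ha ha' => ?_
    · rw [mem_Ico] at ha; rw [mem_range]; omega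
    · rw [mem_range] at ha
      have : a = 0 ∨ a = n := by
        rw [mem_Ico, not_and_or, not_le, not_lt] at ha'
        rcases ha' with h | h <;> omega
      rcases this with rfl | rfl
      · rw [hΛ0, zero_mul]
      · rw [Nat.sub_self, hB0, mul_zero]

/-- Even reindexing of a sum over `range (2m+1)` whose odd terms vanish. [folklore] -/
private theorem sum_range_even (g : ℕ → ℕ) (hg : ∀ k, g (2 * k + 1) = 0) :
    ∀ m : ℕ, ∑ a ∈ range (2 * m + 1), g a = ∑ k ∈ range (m + 1), g (2 * k)
  | 0 => by simp
  | m + 1 => by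
      have h := sum_range_even g hg m
      rw [show 2 * (m + 1) + 1 = 2 * m + 1 + 1 + 1 by ring, sum_range_succ, sum_range_succ, h, hg m, add_zero,
        sum_range_succ (fun k => g (2 * k)) (m + 1), show 2 * m + 1 + 1 = 2 * (m + 1) by ring]

/-- **Kesten's renewal equation by half-length** (face K87.1 of the lane's R87 sketch): for `m ≥ 1`,
`b_{2m}(ℍ) = λ_{2m}(ℍ) + Σ_{1 ≤ k < m} λ_{2k}(ℍ) · b_{2(m-k)}(ℍ)` — odd lengths carry no bridge (`hvIrrLen_odd`).
[cite: MadrasSlade1993, §4.2, eq. (4.2.2), p. 90; Kesten1963SAW, §4] -/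
theorem hvBridgeLen_renewal_even (m : ℕ) (hm : 1 ≤ m) :
    hvBridgeLen (2 * m) = hvIrrLen (2 * m) + ∑ k ∈ Ico 1 m, hvIrrLen (2 * k) * hvBridgeLen (2 * (m - k)) := by
  have h := hvBridgeLen_eq_add_sum (2 * m)
  obtain ⟨B, hB⟩ : ∃ B : ℕ → ℕ, ∀ j, hvBridgeLen j = B j := ⟨_, fun _ => rfl⟩
  obtain ⟨Λ, hΛ⟩ : ∃ Λ : ℕ → ℕ, ∀ j, hvIrrLen j = Λ j := ⟨_, fun _ => rfl⟩
  have hB0 : B 0 = 0 := by rw [← hB, hvBridgeLen_zero]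
  have hΛ0 : Λ 0 = 0 := by rw [← hΛ, hvIrrLen_zero]
  have hΛodd : ∀ k, Λ (2 * k + 1) = 0 := fun k => by rw [← hΛ, hvIrrLen_odd]
  simp only [hB, hΛ] at h ⊢
  rw [h]
  refine congrArg₂ (· + ·) rfl ?_
  -- drop the odd `a`, then the end terms `k = 0` (`λ_0 = 0`) and `k = m` (`b_0 = 0`)
  rw [sum_range_even (fun a => Λ a * B (2 * m - a)) (fun k => by simp only [hΛodd, zero_mul]) m]
  obtain ⟨m', rfl⟩ : ∃ m', m = m' + 1 := ⟨m - 1, by omega⟩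
  rw [sum_range_succ, sum_range_succ', Nat.mul_zero, hΛ0, zero_mul, add_zero, Nat.sub_self, hB0, mul_zero,
    add_zero, sum_Ico_eq_sum_range, Nat.add_sub_cancel]
  refine sum_congr rfl fun k _ => ?_
  rw [add_comm 1 k]
  congr 2
  omega

end Literature.Probability.RandomPlanarGeometry.SAW

end
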